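import Literature.Combinatorics.Sahi2008.ProductOfChains
import Literature.Combinatorics.Sahi2008.FKG

/-!
# `NoHeavyLowerTail` (crux stmt-CriticalPhenomena-4575), Sahi programme P1: the row-quantile (Knothe–Rosenblatt) coupling —
# a weight on `α × Fin (b+1)` with stochastically increasing rows is a monotone image of a product weight on two chains

Support file (Sahi cell, seat `prim-sahi-p1`, generation 2; `--supports stmt-CriticalPhenomena-4575`); part 1 of 2 (the FKG
theorems are in `…SahiTwoDimFKG`).  No definitions: row masses `r_i = Σ_j μ(i,j)` and row distribution functions
`S_i(j) = Σ_{j' ≤ j} μ(i,j')` are written out.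

Lieb–Sahi [LiebSahi2021, Thm. 3.7] prove `E_n(f_1,…,f_n) ≥ 0` for all `n` on the unit square with LEBESGUE measure; the
tree has the discrete form for the uniform grid (`LiebSahiGrid.sahiPositive_uniformGrid`) and for every PRODUCT weight on a
product of two finite chains (`ProductChains.sahiPositive_prodWeight_linearOrder`).  This file proves the conjecture for EVERY
FKG (log-supermodular) probability weight on every product `α × β` of two finite chains (`sahiPositive_of_isFKGMeasure_prod`),
new mathematics not in print.

Proof (Knothe–Rosenblatt / quantile coupling).  (1) Log-supermodularity on `α × β` makes the rows stochastically increasing: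
for `i ≤ i'` and every column `j`, `S_{i'}(j)·r_i ≤ S_i(j)·r_{i'}` where `r_i = μ(row i)` and `S_i(j) = μ{(i,j') : j' ≤ j}`
(`cdf_cross_of_isFKGMeasure`, a sum of `2 × 2` minors).  (2) On the rows of positive mass, let `C ⊂ [0,1]` be the finite set of
normalised values `S_i(j)/r_i` together with `0`, enumerated increasingly by `γ : Fin K ↪o ℝ`, and give `Fin K` the weight
`w₂(u) = γ_u − γ_{u−1}` (a probability weight with partial sums `γ`).  The map `G(i,u) = (i, q_i(u))`,
`q_i(u) = min{j : γ_u r_i ≤ S_i(j)}`, is MONOTONE (in `u` trivially, in `i` by (1)) and pushes the product weight `r ⊗ w₂`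
forward to `μ` exactly (`pushWeight_rowQuantile`).  (3) Hence `μ` is a monotone image of a product weight on a product of two
chains, which is Sahi-positive of every order (`sahiPositive_prodWeight_linearOrder`), and Sahi positivity travels along
monotone maps (`SahiPositive.of_pushWeight`).  Rows of mass zero are removed first (restriction to a sub-chain), and a general
column chain `β` is identified with `Fin (b+1)`.  Corollary `sahiPositive_of_latticeEmbedding_prod`: the same for every finite
distributive lattice that embeds (injectively, preserving `⊓`, `⊔`) into a product of two finite chains — by Dilworth and
Birkhoff these are exactly the FKG posets whose poset of join-irreducibles has width `≤ 2`.
-/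

namespace Summit.CriticalPhenomena.PercolationContinuityZ3.Theorems.SahiTwoDim

open Finset Function Literature.Combinatorics.Sahi2008
open scoped BigOperators

noncomputable section

/-! ## Row masses and row distribution functions -/

section RowCDF

variable {α : Type*} {b : ℕ}

/-- `S_i(last) = r_i`. [this work] -/
theorem rowCDF_last (μ : α × Fin (b + 1) → ℝ) (i : α) : (∑ j', if j' ≤ (Fin.last b) then μ (i, j') else 0) = (∑ j, μ (i, j)) := by
  exact sum_congr rfl fun j _ => if_pos (Fin.le_last j)

/-- `S_i(0) = μ(i,0)`. [this work] -/
theorem rowCDF_zero (μ : α × Fin (b + 1) → ℝ) (i : α) : (∑ j', if j' ≤ 0 then μ (i, j') else 0) = μ (i, 0) := by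
  rw [Finset.sum_eq_single (0 : Fin (b + 1))]
  · rw [if_pos le_rfl]
  · intro j _ hj
    rw [if_neg]
    exact fun h => hj (le_antisymm h (Fin.zero_le _))
  · exact fun h => (h (mem_univ _)).elim

/-- `S_i(j+1) = S_i(j) + μ(i,j+1)`. [this work] -/
theorem rowCDF_succ (μ : α × Fin (b + 1) → ℝ) (i : α) (j : Fin b) :
    (∑ j', if j' ≤ j.succ then μ (i, j') else 0) = (∑ j', if j' ≤ (Fin.castSucc j) then μ (i, j') else 0) + μ (i, j.succ) := by
  have h : ∀ j' : Fin (b + 1), (if j' ≤ j.succ then μ (i, j') else 0) =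
      (if j' ≤ Fin.castSucc j then μ (i, j') else 0) + (if j' = j.succ then μ (i, j') else 0) := by
    intro j'
    by_cases h1 : j' ≤ Fin.castSucc j
    · have h2 : j' ≤ j.succ := h1.trans (Fin.castSucc_le_succ j)
      have h3 : j' ≠ j.succ := fun h => by
        rw [h] at h1
        exact absurd h1 (not_le.2 Fin.castSucc_lt_succ)
      rw [if_pos h2, if_pos h1, if_neg h3, add_zero]
    · by_cases h3 : j' = j.succ
      · rw [if_pos (le_of_eq h3), if_neg h1, if_pos h3, zero_add]
      · have h2 : ¬ j' ≤ j.succ := fun h => by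
          rcases lt_or_eq_of_le h with h | h
          · exact h1 (Fin.le_castSucc_iff.2 h)
          · exact h3 h
        rw [if_neg h2, if_neg h1, if_neg h3, add_zero]
  simp_rw [h]
  rw [sum_add_distrib, sum_ite_eq' univ (j.succ) (fun j' => μ (i, j')), if_pos (mem_univ _)]

/-- `S_i` is nondecreasing in the column for a nonnegative weight. [this work] -/
theorem rowCDF_mono (μ : α × Fin (b + 1) → ℝ) (hμ : ∀ p, 0 ≤ μ p) (i : α) : Monotone (fun j => ∑ j', if j' ≤ j then μ (i, j') else 0) := by
  intro j₁ j₂ h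
  refine sum_le_sum fun j' _ => ?_
  by_cases h1 : j' ≤ j₁
  · rw [if_pos h1, if_pos (h1.trans h)]
  · rw [if_neg h1]
    split_ifs
    · exact hμ _
    · exact le_rfl

/-- `S_i(j) ≥ 0` for a nonnegative weight. [this work] -/
theorem rowCDF_nonneg (μ : α × Fin (b + 1) → ℝ) (hμ : ∀ p, 0 ≤ μ p) (i : α) (j : Fin (b + 1)) :
    0 ≤ (∑ j', if j' ≤ j then μ (i, j') else 0) :=
  sum_nonneg fun j' _ => by split_ifs <;> [exact hμ _; exact le_rfl]

/-- `S_i(j) ≤ r_i` for a nonnegative weight. [this work] -/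
theorem rowCDF_le_rowMass (μ : α × Fin (b + 1) → ℝ) (hμ : ∀ p, 0 ≤ μ p) (i : α) (j : Fin (b + 1)) :
    (∑ j', if j' ≤ j then μ (i, j') else 0) ≤ (∑ j, μ (i, j)) := by
  rw [← rowCDF_last]
  exact rowCDF_mono μ hμ i (Fin.le_last j)

/-- The row masses sum to the total mass. [this work] -/
theorem sum_rowMass [Fintype α] (μ : α × Fin (b + 1) → ℝ) : ∑ i, (∑ j, μ (i, j)) = ∑ p, μ p := by
  rw [← Finset.sum_product', univ_product_univ]

/-- **Log-supermodularity makes the rows stochastically increasing**: `S_{i'}(j)·r_i ≤ S_i(j)·r_{i'}` for `i ≤ i'`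
(sum of the `2×2` minors `μ(i',j₁)μ(i,j₂) ≤ μ(i,j₁)μ(i',j₂)`, `j₁ ≤ j < j₂`). [this work] -/
theorem cdf_cross_of_mul_le_mul [LinearOrder α] (μ : α × Fin (b + 1) → ℝ)
    (hμ : ∀ p q, μ p * μ q ≤ μ (p ⊓ q) * μ (p ⊔ q)) {i i' : α} (hii' : i ≤ i') (j : Fin (b + 1)) :
    (∑ j', if j' ≤ j then μ (i', j') else 0) * (∑ j, μ (i, j)) ≤ (∑ j', if j' ≤ j then μ (i, j') else 0) * (∑ j, μ (i', j)) := by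
  -- split r = S(j) + T(j) with T the tail sum
  have hsplit : ∀ k : α, (∑ j, μ (k, j)) = (∑ j', if j' ≤ j then μ (k, j') else 0) + ∑ j', if j < j' then μ (k, j') else 0 := by
    intro k
    rw [← sum_add_distrib]
    refine sum_congr rfl fun j' _ => ?_
    by_cases h : j' ≤ j
    · rw [if_pos h, if_neg (not_lt.2 h), add_zero]
    · rw [if_neg h, if_pos (not_le.1 h), zero_add]
  rw [hsplit i, hsplit i', mul_add, mul_add, mul_comm ((∑ j', if j' ≤ j then μ (i', j') else 0)) ((∑ j', if j' ≤ j then μ (i, j') else 0))]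
  refine add_le_add le_rfl ?_
  -- S_{i'}(j) T_i(j) ≤ S_i(j) T_{i'}(j): termwise minors
  rw [sum_mul, sum_mul]
  refine sum_le_sum fun j₁ _ => ?_
  rw [mul_sum, mul_sum]
  refine sum_le_sum fun j₂ _ => ?_
  by_cases h1 : j₁ ≤ j
  · by_cases h2 : j < j₂
    · rw [if_pos h1, if_pos h1, if_pos h2, if_pos h2]
      have h12 : j₁ ≤ j₂ := h1.trans h2.le
      have key := hμ (i', j₁) (i, j₂)
      have hinf : ((i', j₁) : α × Fin (b + 1)) ⊓ (i, j₂) = (i, j₁) := by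
        ext <;> simp [min_eq_right hii', min_eq_left h12]
      have hsup : ((i', j₁) : α × Fin (b + 1)) ⊔ (i, j₂) = (i', j₂) := by
        ext <;> simp [max_eq_left hii', max_eq_right h12]
      rw [hinf, hsup] at key
      exact key
    · rw [if_neg h2, if_neg h2, mul_zero, mul_zero]
  · rw [if_neg h1, if_neg h1, zero_mul, zero_mul]

end RowCDF

/-! ## The quantile coupling on a common grid -/

section Coupling

variable {α : Type*} [LinearOrder α] [Fintype α] {b K : ℕ}

/-- Telescoping: the gap weights `γ_{u+1} − γ_u` of the first `m` gaps sum to `γ_m − γ_0`. [folklore] -/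
theorem sum_gaps (γ : Fin (K + 1) → ℝ) : ∀ (m : ℕ) (hm : m ≤ K),
    ∑ u ∈ univ.filter (fun u : Fin K => (u : ℕ) < m), (γ u.succ - γ (Fin.castSucc u)) = γ ⟨m, by omega⟩ - γ 0
  | 0, _ => by
    rw [Finset.sum_eq_zero fun u hu => ?_]
    · simp
    · simp at hu
  | m + 1, hm => by
    have ih := sum_gaps γ m (by omega)
    have hset : univ.filter (fun u : Fin K => (u : ℕ) < m + 1) =
        insert (⟨m, by omega⟩ : Fin K) (univ.filter fun u : Fin K => (u : ℕ) < m) := by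
      ext u
      simp only [mem_filter, mem_univ, true_and, mem_insert, Fin.ext_iff]
      omega
    rw [hset, sum_insert (by simp), ih]
    have h1 : (Fin.succ (⟨m, by omega⟩ : Fin K)) = (⟨m + 1, by omega⟩ : Fin (K + 1)) := by
      ext; simp
    have h2 : (Fin.castSucc (⟨m, by omega⟩ : Fin K)) = (⟨m, by omega⟩ : Fin (K + 1)) := by
      ext; simp
    rw [h1, h2]
    ring

/-- The gap weights of an increasing grid `0 = γ_0 ≤ ⋯ ≤ γ_K = 1` form a probability weight on `Fin K`. [folklore] -/
theorem sum_gaps_univ (γ : Fin (K + 1) → ℝ) (hγ0 : γ 0 = 0) (hγ1 : γ (Fin.last K) = 1) :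
    ∑ u : Fin K, (γ u.succ - γ (Fin.castSucc u)) = 1 := by
  have h := sum_gaps γ K le_rfl
  have hset : univ.filter (fun u : Fin K => (u : ℕ) < K) = univ := by
    ext u; simp
  rw [hset] at h
  rw [h, hγ0, sub_zero]
  exact hγ1

/-- **The row-quantile coupling.**  Let `μ ≥ 0` on `α × Fin (b+1)` have positive row masses and stochastically increasing
rows (`S_{i'}(j) r_i ≤ S_i(j) r_{i'}` for `i ≤ i'`), and let `γ : Fin (K+1) → ℝ` be a strictly increasing grid from `0` to `1`
containing every normalised value `S_i(j)/r_i`.  Then `G(i,u) = (i, min{j : γ_{u+1} r_i ≤ S_i(j)})` is monotone on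
`α × Fin K` and pushes the product weight `r_i (γ_{u+1} − γ_u)` forward to `μ`. [this work] -/
theorem exists_rowQuantile_coupling (μ : α × Fin (b + 1) → ℝ) (hμ0 : ∀ p, 0 ≤ μ p) (hrow : ∀ i, 0 < (∑ j, μ (i, j)))
    (hcross : ∀ i i' j, i ≤ i' → (∑ j', if j' ≤ j then μ (i', j') else 0) * (∑ j, μ (i, j)) ≤ (∑ j', if j' ≤ j then μ (i, j') else 0) * (∑ j, μ (i', j)))
    (γ : Fin (K + 1) → ℝ) (hγ : StrictMono γ) (hγ1 : γ (Fin.last K) = 1) (hγ0 : γ 0 = 0)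
    (hC : ∀ i j, ∃ v, γ v * (∑ j, μ (i, j)) = (∑ j', if j' ≤ j then μ (i, j') else 0)) :
    ∃ G : α × Fin K → α × Fin (b + 1), Monotone G ∧
      pushWeight (fun p : α × Fin K => (∑ j, μ (p.1, j)) * (γ p.2.succ - γ (Fin.castSucc p.2))) G = μ := by
  classical
  -- the column map and its characterisation `q i u ≤ j ↔ γ_{u+1} r_i ≤ S_i(j)`
  have hne : ∀ i (u : Fin K), (univ.filter fun j : Fin (b + 1) => γ u.succ * (∑ j, μ (i, j)) ≤ (∑ j', if j' ≤ j then μ (i, j') else 0)).Nonempty := by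
    intro i u
    refine ⟨Fin.last b, ?_⟩
    rw [mem_filter, rowCDF_last]
    refine ⟨mem_univ _, ?_⟩
    have hle : γ u.succ ≤ 1 := by rw [← hγ1]; exact hγ.monotone (Fin.le_last _)
    nlinarith [hrow i]
  obtain ⟨q, hq⟩ : ∃ q : α → Fin K → Fin (b + 1), ∀ i u j, q i u ≤ j ↔ γ u.succ * (∑ j, μ (i, j)) ≤ (∑ j', if j' ≤ j then μ (i, j') else 0) := by
    refine ⟨fun i u => (univ.filter fun j : Fin (b + 1) => γ u.succ * (∑ j, μ (i, j)) ≤ (∑ j', if j' ≤ j then μ (i, j') else 0)).min' (hne i u),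
      fun i u j => ⟨fun h => ?_, fun h => ?_⟩⟩
    · have hmem := min'_mem _ (hne i u)
      rw [mem_filter] at hmem
      exact hmem.2.trans (rowCDF_mono μ hμ0 i h)
    · exact min'_le _ _ (by rw [mem_filter]; exact ⟨mem_univ _, h⟩)
  -- `q` is monotone in both arguments
  have hqmono : ∀ i i' (u u' : Fin K), i ≤ i' → u ≤ u' → q i u ≤ q i' u' := by
    intro i i' u u' hii' huu'
    rw [hq]
    have h1 : γ u'.succ * (∑ j, μ (i', j)) ≤ (∑ j', if j' ≤ (q i' u') then μ (i', j') else 0) := (hq i' u' _).1 le_rfl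
    have h2 : γ u.succ ≤ γ u'.succ := hγ.monotone (Fin.succ_le_succ_iff.2 huu')
    have h3 := hcross i i' (q i' u') hii'
    have hri := hrow i
    have hri' := hrow i'
    -- γ_{u'+1} r_i r_{i'} ≤ S_{i'} r_i ≤ S_i r_{i'}
    nlinarith [mul_le_mul_of_nonneg_right h1 hri.le, mul_le_mul_of_nonneg_right h2 hri.le]
  refine ⟨fun p => (p.1, q p.1 p.2), fun p p' hpp' => ⟨hpp'.1, hqmono _ _ _ _ hpp'.1 hpp'.2⟩, ?_⟩
  -- the push-forward: cumulative fibre sums are the row distribution functions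
  have hcum : ∀ i j, (∑ j, μ (i, j)) * ∑ u ∈ univ.filter (fun u : Fin K => q i u ≤ j),
      (γ u.succ - γ (Fin.castSucc u)) = (∑ j', if j' ≤ j then μ (i, j') else 0) := by
    intro i j
    obtain ⟨v, hv⟩ := hC i j
    have hset : univ.filter (fun u : Fin K => q i u ≤ j) = univ.filter (fun u : Fin K => (u : ℕ) < v) := by
      ext u
      simp only [mem_filter, mem_univ, true_and, hq, ← hv]
      rw [mul_le_mul_iff_of_pos_right (hrow i), hγ.le_iff_le, Fin.le_def, Fin.val_succ]
      omega
    rw [hset, sum_gaps γ v (by omega), hγ0, sub_zero]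
    have : (⟨(v : ℕ), by omega⟩ : Fin (K + 1)) = v := Fin.ext rfl
    rw [this, mul_comm, hv]
  have hfib : ∀ i j, (∑ j, μ (i, j)) * ∑ u ∈ univ.filter (fun u : Fin K => q i u = j),
      (γ u.succ - γ (Fin.castSucc u)) = μ (i, j) := by
    intro i j
    induction j using Fin.cases with
    | zero =>
      have hset : univ.filter (fun u : Fin K => q i u = 0) = univ.filter (fun u : Fin K => q i u ≤ 0) := by
        ext u; simp
      rw [hset, hcum, rowCDF_zero]
    | succ j' =>
      have hset : univ.filter (fun u : Fin K => q i u ≤ j'.succ) =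
          univ.filter (fun u : Fin K => q i u ≤ Fin.castSucc j') ∪ univ.filter (fun u : Fin K => q i u = j'.succ) := by
        ext u
        simp only [mem_filter, mem_univ, true_and, mem_union]
        constructor
        · intro h
          rcases lt_or_eq_of_le h with h | h
          · exact Or.inl (Fin.le_castSucc_iff.2 h)
          · exact Or.inr h
        · rintro (h | h)
          · exact h.trans (Fin.castSucc_le_succ j')
          · exact h.le
      have hdisj : Disjoint (univ.filter (fun u : Fin K => q i u ≤ Fin.castSucc j'))
          (univ.filter (fun u : Fin K => q i u = j'.succ)) := by
        rw [disjoint_filter]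
        intro u _ h1 h2
        rw [h2] at h1
        exact absurd h1 (not_le.2 Fin.castSucc_lt_succ)
      have h := hcum i j'.succ
      rw [hset, sum_union hdisj, mul_add, hcum, rowCDF_succ] at h
      linarith
  funext ⟨i, j⟩
  rw [pushWeight_apply, Fintype.sum_prod_type, Finset.sum_eq_single i]
  · rw [← hfib i j, mul_sum, ← sum_filter]
    refine sum_congr ?_ fun u _ => rfl
    ext u
    simp
  · intro i' _ hi'
    refine sum_eq_zero fun u _ => ?_
    rw [if_neg]
    intro h
    exact hi' (Prod.mk.inj h).1
  · exact fun h => (h (mem_univ _)).elim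

/-- **Core theorem** (rows of positive mass, columns `Fin (b+1)`): a probability weight on `α × Fin (b+1)` with
stochastically increasing rows is Sahi-positive of every order — it is a monotone image of a product weight on a product
of two chains (`sahiPositive_prodWeight_linearOrder`, `SahiPositive.of_pushWeight`). [this work] -/
theorem sahiPositive_of_cdf_cross [Nonempty α] (μ : α × Fin (b + 1) → ℝ) (hμ0 : ∀ p, 0 ≤ μ p) (hμ1 : ∑ p, μ p = 1)
    (hrow : ∀ i, 0 < (∑ j, μ (i, j)))
    (hcross : ∀ i i' j, i ≤ i' → (∑ j', if j' ≤ j then μ (i', j') else 0) * (∑ j, μ (i, j)) ≤ (∑ j', if j' ≤ j then μ (i, j') else 0) * (∑ j, μ (i', j))) (n : ℕ) :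
    SahiPositive μ n := by
  classical
  -- the common grid of normalised distribution values
  obtain ⟨C, hC⟩ : ∃ C : Finset ℝ, C = insert 0 (univ.image fun p : α × Fin (b + 1) => (∑ j', if j' ≤ p.2 then μ (p.1, j') else 0) / (∑ j, μ (p.1, j))) :=
    ⟨_, rfl⟩
  have h0C : (0 : ℝ) ∈ C := by rw [hC]; exact mem_insert_self _ _
  have hmemC : ∀ i j, (∑ j', if j' ≤ j then μ (i, j') else 0) / (∑ j, μ (i, j)) ∈ C := fun i j => by
    rw [hC]; exact mem_insert_of_mem (mem_image_of_mem _ (mem_univ (i, j)))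
  obtain ⟨i₀⟩ := ‹Nonempty α›
  have h1C : (1 : ℝ) ∈ C := by
    have h := hmemC i₀ (Fin.last b)
    rwa [rowCDF_last, div_self (hrow i₀).ne'] at h
  have hCbounds : ∀ c ∈ C, 0 ≤ c ∧ c ≤ 1 := by
    intro c hc
    rw [hC, mem_insert, mem_image] at hc
    rcases hc with rfl | ⟨p, _, rfl⟩
    · exact ⟨le_rfl, zero_le_one⟩
    · exact ⟨div_nonneg (rowCDF_nonneg μ hμ0 _ _) (hrow _).le,
        (div_le_one (hrow _)).2 (rowCDF_le_rowMass μ hμ0 _ _)⟩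
  have hcard : 2 ≤ C.card := by
    have : ({0, 1} : Finset ℝ) ⊆ C := by
      intro c hc
      simp only [mem_insert, mem_singleton] at hc
      rcases hc with rfl | rfl
      · exact h0C
      · exact h1C
    calc 2 = ({0, 1} : Finset ℝ).card := by rw [card_pair zero_ne_one]
      _ ≤ C.card := card_le_card this
  obtain ⟨K, hK⟩ : ∃ K, C.card = K + 1 := Nat.exists_eq_succ_of_ne_zero (by omega)
  have hKpos : 0 < K := by omega
  haveI : Nonempty (Fin K) := ⟨⟨0, hKpos⟩⟩
  obtain ⟨γ, hγdef⟩ : ∃ γ : Fin (K + 1) → ℝ, γ = fun v => C.orderEmbOfFin hK v := ⟨_, rfl⟩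
  have hγ : StrictMono γ := by rw [hγdef]; exact (C.orderEmbOfFin hK).strictMono
  have hγ0 : γ 0 = 0 := by
    rw [hγdef]
    show C.orderEmbOfFin hK ⟨0, by omega⟩ = 0
    rw [orderEmbOfFin_zero hK (by omega)]
    exact le_antisymm (min'_le _ _ h0C) ((hCbounds _ (min'_mem _ _)).1)
  have hγ1 : γ (Fin.last K) = 1 := by
    rw [hγdef]
    show C.orderEmbOfFin hK ⟨K, by omega⟩ = 1
    have h := orderEmbOfFin_last hK (by omega)
    simp only [Nat.add_sub_cancel] at h
    rw [h]
    exact le_antisymm ((hCbounds _ (max'_mem _ _)).2) (le_max' _ _ h1C)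
  have hCγ : ∀ i j, ∃ v, γ v * (∑ j, μ (i, j)) = (∑ j', if j' ≤ j then μ (i, j') else 0) := by
    intro i j
    have h : (∑ j', if j' ≤ j then μ (i, j') else 0) / (∑ j, μ (i, j)) ∈ Set.range (C.orderEmbOfFin hK) := by
      rw [range_orderEmbOfFin]; exact hmemC i j
    obtain ⟨v, hv⟩ := h
    refine ⟨v, ?_⟩
    rw [hγdef]
    show C.orderEmbOfFin hK v * (∑ j, μ (i, j)) = (∑ j', if j' ≤ j then μ (i, j') else 0)
    rw [hv, div_mul_cancel₀ _ (hrow i).ne']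
  obtain ⟨G, hGmono, hGpush⟩ := exists_rowQuantile_coupling μ hμ0 hrow hcross γ hγ hγ1 hγ0 hCγ
  rw [← hGpush]
  refine SahiPositive.of_pushWeight ?_ hGmono
  refine ProductChains.sahiPositive_prodWeight_linearOrder (fun i => ∑ j, μ (i, j)) (fun u : Fin K => γ u.succ - γ (Fin.castSucc u))
    (fun i => (hrow i).le) ?_ (fun u => sub_nonneg.2 (hγ.monotone (Fin.castSucc_le_succ u))) (sum_gaps_univ γ hγ0 hγ1) n
  rw [sum_rowMass, hμ1]

end Coupling

end

end Summit.CriticalPhenomena.PercolationContinuityZ3.Theorems.SahiTwoDim
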